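/-
Copyright (c) 2026 the pub-hodgecm-mathlib formalisation cell (harness21).  Prover seat hodgecm-mathlib-F0P3a-p01 (g18): road «S3-ram», (Cnt2′) ROUTE B, chair F0P3a-p07 (g15)
RULINGS (16)(c)∕(17)∕(18) — «HYP ROOT CENSUS IN PARAMS CURRENCY» (F0P3-p01 (g19) 05:13:27Z ask (i)), CM dress at the J0diff + (h1) binders; 2026-09-02.
-/
import Literature.NumberTheory.Rogawski1990.DepthZeroKappaTransferTypeTwoRamifiedHyperbolicTotalsPm      -- ★ p849335 (F0P3a-p08 (g20)): the pm socket head (its `hsR hNE hNP hNM` texts are the targets); brings the CM dictionary imports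
import Literature.NumberTheory.Rogawski1990.DepthZeroKappaTransferTypeTwoRamifiedHyperbolicRootCensus    -- ★ p849494 (this seat); brings ★ p849462 (residual data), ★ p849383 (junction), ★ p849330 (root package)
import Literature.NumberTheory.Rogawski1990.TypeTwoRamifiedFrameLiteralRootRegion                         -- ★ p849354 (A-p19 (g29)): W-side transport, `v_det_rerootedCentred_sub_one_eq_ram`, `det_coe_inv_conj_scalar_mul_sub_one`; brings A-p12 ★ `…WSideBalls`, chair ★ dictionary
import Literature.NumberTheory.Rogawski1990.DepthZeroKappaTransferTypeTwoRamifiedDepthSign                -- ★ p849319 (chair): `typeTwo_hilbertSymbol_eq_one_iff_exists_sq_ram`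
import Literature.NumberTheory.Automorphic.UnitaryLatticeTreeFramesOfInvolution                             -- ★ `isTree_latticeGraph_three_of_neg`
import Literature.NumberTheory.Automorphic.UnitaryLatticeTreeResidualTokens                                 -- ★ `exists_unit_v_sub_mul_sq_lt_one_iff_residue`; brings ★ `exists_ne_zero_eq_mul_sq_iff_quadraticChar`
import HarnessLib

/-!
# «HYP ROOT CENSUS IN PARAMS CURRENCY» — the hyperbolic literal's root region and collar atoms at odd root depth, as residual-conic fibres
# (Rogawski 1990 §4.9; Kottwitz 1986 §3; Labesse–Langlands 1979 §2; Bruhat–Tits 1972 §10)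

Topic `NumberTheory/Rogawski1990`; namespace `Literature.NumberTheory.Rogawski1990.BlockLawHyp`.  THEOREMS ONLY; kernel lane `--supports stmt-HodgeConjecture-24833`; cell
`pub/hodgecm-mathlib` (D-0151), crux H413; road «S3-ram» (count-neutral).

`hyperbolicRootCensus_params_odd_ram` (F0P3-p01 (g19)'s ask (i), 05:13:27Z; chair F0P3a-p07 (g15) RULING (18)): at the J0diff binders (`hblk hu2 hirr hdisc hm hβ`, regimes
A-odd ∕ C: `m = 2n + 1`) and (h1)'s `(s hs k hk hd γ' hγ')` — the SAME binders ★ p849287 ∕ ★ p849335 (F0P3a-p08 (g20)) take — and a unit class constant `c = c₀`: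
there is the integral leading matrix `Y = (ϖ^m)⁻¹(B₀ − 1)` of `B₀ = k⁻¹(s·ĝ_w)k` with
* `Ȳ₀₀ = Ȳ₁₁` (unitarity at odd depth), `χ(Ȳ₀₁Ȳ₁₀) = −1` (irreducible residual block) — the `hdiag`∕`hirr` binders of ★ p849462 `natCard_conicNull_of_iotaShape` and of F0P3a-p02
  (g18)'s ι-shape adapter;
* `(β, θ)_v = 1 ⟺ χ(det Ȳ) = 1` (★ chair p849319 ∘ `det(B₀ − 1) = s²·(χ_g(u))_w`);
* the root region of `Γ = ι(B₀, 1)` at level `ϖ^m` is `{L₀}` (★ p849287∕p849335's `hsR` at `sR := {L₀}`);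
* the three collar sums of ★ p849287∕p849335's `hNE hNP hNM` at `sR := {L₀}` equal `q·#{p : Q(x_p) = 0}`, `q·#{p : χ((−c̄₀)⁻¹Q(x_p)) = 1}`, `q·#{p : χ((−c̄₀)⁻¹Q(x_p)) = −1}`
  for `Q(x) = ᵗx·(J̄₀·ι(Ȳ, 0))·x` on ★ G3⁗'s `q + 1` conic points (`Ȳ' = ι(Ȳ, 0)` written as an explicit `3 × 3` matrix).
So the pm joint cell `stub_Zpair_pm_odd_A` (assembler F0P3-p01 (g19)) and the zero cell are pure compositions: ★ p849335 ∕ ★ p849287 at `sR := {L₀}` with these atoms, p02's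
ι-shape laws for `#{…}`, the cross law ★ p849473, and the sign clause here.  Proof = the dress of ★ p849531's cell (`zhyp_zero_odd_A_ram`) with the atoms exported instead of
summed: W-root-set `{𝒪²}` by ★ A-p19 p849354 ∘ chair ★ `typeTwo_depthDictionary_odd_ram` ∘ A-p12 ★ odd balls (`j = n`); ★ p849330 root package with `νX :=` the child-set
sizes; ★ p849383 junction; ★ p849462 residual data; sign via ★ `exists_unit_v_sub_mul_sq_lt_one_iff_residue`.
HONEST LABEL: HC_CM is proved only modulo the 2 remaining named inputs (hLiu418 24832, h413 24833) until rung 0 closes; composition of ★ theorems; «S3-ram» has no books consequence.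

## References
* [Rogawski1990] J. D. Rogawski, *Automorphic Representations of Unitary Groups in Three Variables*, Ann. of Math. Stud. 123 (1990), §4.9 Prop. 4.9.1 (b) p. 55, Lemma 4.9.3 p. 56.
* [Kottwitz1986] R. E. Kottwitz, *Base change for unit elements of Hecke algebras*, Compositio Math. 60 (1986), §3.
* [LabesseLanglands1979] J.-P. Labesse, R. P. Langlands, *L-indistinguishability for SL(2)*, Canad. J. Math. 31 (1979), §2 Lemma 2.1.
* [BruhatTits1972] F. Bruhat, J. Tits, *Groupes réductifs sur un corps local I*, Publ. Math. IHÉS 41 (1972), §10.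
-/

set_option autoImplicit false

noncomputable section

open NumberField IsDedekindDomain Matrix Polynomial ValuativeRel
open Literature.NumberTheory.Automorphic Literature.NumberTheory.Automorphic.UnitaryGroup
open Literature.NumberTheory.Automorphic.UnitaryLatticeTree Literature.NumberTheory.Automorphic.HermitianLattice
open Literature.NumberTheory.GaloisRepresentations Literature.NumberTheory.QuadraticForms
open Literature.NumberTheory.Rogawski1990 Literature.NumberTheory.Rogawski1990.TypeOneRamifiedJunction
open scoped Matrix MatrixGroups ValuativeRel WithZero

namespace Literature.NumberTheory.Rogawski1990.BlockLawHyp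

variable (L : Type) [Field L] [NumberField L] [IsCMField L] {v : HeightOneSpectrum (𝓞 ↥(maximalRealSubfield L))}

set_option maxHeartbeats 3200000 in
-- budget only: statement-heavy socket tokens (★ p849335's `hsR hNE hNP hNM` texts verbatim); the proof is a composition of ★ heads.
/-- **«HYP ROOT CENSUS IN PARAMS CURRENCY»** (regimes A-odd ∕ C, `m = 2n+1`; see the module docstring): the leading matrix `Y` of `B₀ = k⁻¹(s·ĝ_w)k` with its residual
symmetry∕irreducibility, the sign clause `(β,θ)_v = 1 ⟺ χ(det Ȳ) = 1`, the root region `{L₀}` and the three collar sums of ★ p849287∕p849335 at `sR := {L₀}` as `q` times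
residual-conic fibres. [cite: Rogawski1990, §4.9 Prop. 4.9.1 (b) p. 55, Lemma 4.9.3 p. 56] [cite: Kottwitz1986, §3] [cite: LabesseLanglands1979, §2 Lemma 2.1] [cite: BruhatTits1972, §10] -/
theorem hyperbolicRootCensus_params_odd_ram (w : PlacesOver L v)
    (hw : IsCMField.complexConj L • w.1 = w.1) (he : v.asIdeal.ramificationIdx' w.1.asIdeal ≠ 1)
    (h2 : IsUnit (2 : 𝒪[(w.1.adicCompletion L)]))
    (ϖ : w.1.adicCompletion L) (hϖ : Valued.v ϖ = WithZero.exp (-1 : ℤ)) (hσϖ : galAdicCompletionMap (L := L) (IsCMField.complexConj L) hw ϖ = -ϖ)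
    (γH : ((cmDatum L 2 (Matrix.of fun i j : Fin 2 => if i.val + j.val + 1 = 2 then (1 : L) else 0)).Local v ×
      (cmDatum L 1 (Matrix.of fun i j : Fin 1 => if i.val + j.val + 1 = 1 then (1 : L) else 0)).Local v))
    (hblk : ∀ i j : Fin 2, Valued.v (((((γH.1.val : GL (Fin 2) (UnitaryGroup.LocalRing L v)).val.map (Pi.evalRingHom (fun w' : PlacesOver L v => w'.1.adicCompletion L) w))) - 1) i j) ≤ Valued.v (ϖ ^ 2))
    (hu2 : Valued.v (finGammaTwo L v γH w - 1) ≤ Valued.v (ϖ ^ 2))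
    (hirr : ¬ ∃ x : (w.1.adicCompletion L), ((((γH.1.val : GL (Fin 2) (UnitaryGroup.LocalRing L v)).val.map
      (Pi.evalRingHom (fun w' : PlacesOver L v => w'.1.adicCompletion L) w))).charpoly).IsRoot x)
    {n : ℕ} (hdisc : Valued.v ((((γH.1.val : GL (Fin 2) (UnitaryGroup.LocalRing L v)).val.map (Pi.evalRingHom (fun w' : PlacesOver L v => w'.1.adicCompletion L) w))).trace ^ 2 - 4 * (((γH.1.val : GL (Fin 2) (UnitaryGroup.LocalRing L v)).val.map (Pi.evalRingHom (fun w' : PlacesOver L v => w'.1.adicCompletion L) w))).det) = WithZero.exp (-((2 * (2 * n + 1) : ℕ) : ℤ)))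
    (hn : 1 ≤ n) (m : ℕ) (hm : Valued.v (((finCharpolyTwo L v γH).eval (finGammaTwo L v γH)) w) =
          Valued.v ((toPlace v w (HeckeCharacter.uniformizer ↥(maximalRealSubfield L) v : v.adicCompletion ↥(maximalRealSubfield L))) ^ m))
    (β : (v.adicCompletion ↥(maximalRealSubfield L))ˣ)
    (hβ : toPlace v w (β : v.adicCompletion ↥(maximalRealSubfield L)) =
          -(((finCharpolyTwo L v γH).eval (finGammaTwo L v γH)) w *
              (finGammaTwo L v γH w ^ 2 +
                ((γH.1.val.val : Matrix (Fin 2) (Fin 2) (LocalRing L v)).map (Pi.evalRingHom (fun w' : PlacesOver L v => w'.1.adicCompletion L) w)).det)) /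
            (2 * finGammaTwo L v γH w ^ 2 *
              ((γH.1.val.val : Matrix (Fin 2) (Fin 2) (LocalRing L v)).map (Pi.evalRingHom (fun w' : PlacesOver L v => w'.1.adicCompletion L) w)).det))
    (hmN : m = 2 * n + 1)
    (s : (w.1.adicCompletion L)ˣ) (hs : (s : w.1.adicCompletion L) * (((localNonsplitEquiv (IsCMField.complexConj L) (Matrix.of fun i j : Fin 1 => if i.val + j.val + 1 = 1 then (1 : L) else 0) (IsCMField.complexConj_ne_one L) w hw γH.2).val : GL (Fin 1) (w.1.adicCompletion L)) : Matrix (Fin 1) (Fin 1) (w.1.adicCompletion L)) 0 0 = 1)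
    (k : GL (Fin 2) (w.1.adicCompletion L))
    (hk : k ∈ unitaryGroupOfForm (galAdicCompletionMap (L := L) (IsCMField.complexConj L) hw)
      (placeForm (Matrix.of fun i j : Fin 2 => if i.val + j.val + 1 = 2 then (1 : L) else 0) w.1))
    (hd : ∀ i j, Valued.v (((((k⁻¹ * (Matrix.GeneralLinearGroup.scalar (Fin 2) s * ((localNonsplitEquiv (IsCMField.complexConj L) (Matrix.of fun i j : Fin 2 => if i.val + j.val + 1 = 2 then (1 : L) else 0) (IsCMField.complexConj_ne_one L) w hw γH.1).val : GL (Fin 2) (w.1.adicCompletion L))) * k) : GL (Fin 2) (w.1.adicCompletion L)) : Matrix (Fin 2) (Fin 2) (w.1.adicCompletion L)) - 1) i j) ≤ Valued.v ϖ ^ m)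
    (γ' : unitaryGroupOfForm (galAdicCompletionMap (L := L) (IsCMField.complexConj L) hw) ((StdForm.antidiagonal 3).over (w.1.adicCompletion L)))
    (hγ' : (γ' : GL (Fin 3) (w.1.adicCompletion L)) = endoGL ((k⁻¹ * (Matrix.GeneralLinearGroup.scalar (Fin 2) s * ((localNonsplitEquiv (IsCMField.complexConj L) (Matrix.of fun i j : Fin 2 => if i.val + j.val + 1 = 2 then (1 : L) else 0) (IsCMField.complexConj_ne_one L) w hw γH.1).val : GL (Fin 2) (w.1.adicCompletion L))) * k), (1 : GL (Fin 1) (w.1.adicCompletion L))))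
    [Fintype (Valued.ResidueField (w.1.adicCompletion L))] [DecidableEq (Valued.ResidueField (w.1.adicCompletion L))] 
    (c : w.1.adicCompletion L) (c₀ : Valued.integer (w.1.adicCompletion L)) (hc₀ : (c₀ : w.1.adicCompletion L) = c) (hc : Valued.v c = 1) :
    ∃ Y : Matrix (Fin 2) (Fin 2) (Valued.integer (w.1.adicCompletion L)),
    (∀ i j, ((Y i j : Valued.integer (w.1.adicCompletion L)) : (w.1.adicCompletion L)) = (ϖ ^ m)⁻¹ * (((k⁻¹ * (Matrix.GeneralLinearGroup.scalar (Fin 2) s * ((localNonsplitEquiv (IsCMField.complexConj L) (Matrix.of fun i j : Fin 2 => if i.val + j.val + 1 = 2 then (1 : L) else 0) (IsCMField.complexConj_ne_one L) w hw γH.1).val : GL (Fin 2) (w.1.adicCompletion L))) * k : GL (Fin 2) (w.1.adicCompletion L)) : Matrix (Fin 2) (Fin 2) (w.1.adicCompletion L)) - 1) i j) ∧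
    IsLocalRing.residue (Valued.integer (w.1.adicCompletion L)) (Y 0 0) = IsLocalRing.residue (Valued.integer (w.1.adicCompletion L)) (Y 1 1) ∧
    quadraticChar (Valued.ResidueField (w.1.adicCompletion L)) (IsLocalRing.residue (Valued.integer (w.1.adicCompletion L)) (Y 0 1) * IsLocalRing.residue (Valued.integer (w.1.adicCompletion L)) (Y 1 0)) = -1 ∧
    (hilbertSymbol (v.adicCompletion ↥(maximalRealSubfield L)) (β : v.adicCompletion ↥(maximalRealSubfield L)) (algebraMap ↥(maximalRealSubfield L) _ ((cmQuadraticGenerator L : 𝓞 ↥(maximalRealSubfield L)) : ↥(maximalRealSubfield L))) = 1 ↔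
      quadraticChar (Valued.ResidueField (w.1.adicCompletion L)) (IsLocalRing.residue (Valued.integer (w.1.adicCompletion L)) (Y 0 0 * Y 1 1 - Y 0 1 * Y 1 0)) = 1) ∧
    (∀ vtx, vtx ∈ ({⟨stdLattice (w.1.adicCompletion L) 3, 0, isSelfDualLattice_stdLattice_three_of_v hϖ⟩} : Finset {M : Submodule (Valued.integer (w.1.adicCompletion L)) (Fin 3 → (w.1.adicCompletion L)) // IsVertex (galAdicCompletionMap (L := L) (IsCMField.complexConj L) hw) ϖ ((StdForm.antidiagonal 3).over (w.1.adicCompletion L)) M}) ↔ vtx ∈ {vtx : {M : Submodule (Valued.integer (w.1.adicCompletion L)) (Fin 3 → (w.1.adicCompletion L)) // IsVertex (galAdicCompletionMap (L := L) (IsCMField.complexConj L) hw) ϖ ((StdForm.antidiagonal 3).over (w.1.adicCompletion L)) M} | latticeGraphIso (galAdicCompletionMap (L := L) (IsCMField.complexConj L) hw) ϖ ((StdForm.antidiagonal 3).over (w.1.adicCompletion L)) γ' vtx = vtx ∧ IsSelfDualLattice (galAdicCompletionMap (L := L) (IsCMField.complexConj L) hw) ϖ ((StdForm.antidiagonal 3).over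 (w.1.adicCompletion L)) vtx.1 ∧ vtx.1.map ((Matrix.toLin' (((γ' : GL (Fin 3) (w.1.adicCompletion L)) : Matrix (Fin 3) (Fin 3) (w.1.adicCompletion L)) - 1)).restrictScalars (Valued.integer (w.1.adicCompletion L))) ≤ scaleLattice (ϖ ^ m) vtx.1}) ∧
    (∑ vtx ∈ ({⟨stdLattice (w.1.adicCompletion L) 3, 0, isSelfDualLattice_stdLattice_three_of_v hϖ⟩} : Finset {M : Submodule (Valued.integer (w.1.adicCompletion L)) (Fin 3 → (w.1.adicCompletion L)) // IsVertex (galAdicCompletionMap (L := L) (IsCMField.complexConj L) hw) ϖ ((StdForm.antidiagonal 3).over (w.1.adicCompletion L)) M}), ({wtx | wtx ∈ {wtx | ∃ cx, ((latticeGraph (galAdicCompletionMap (L := L) (IsCMField.complexConj L) hw) ϖ ((StdForm.antidiagonal 3).over (w.1.adicCompletion L))).Adj vtx cx ∧ (latticeGraph (galAdicCompletionMap (L := L) (IsCMField.complexConj L) hw) ϖ ((StdForm.antidiagonal 3).over (w.1.adicCompletion L))).dist ⟨stdLattice (w.1.adicCompletion L) 3, 0, isSelfDualLattice_stdLattice_three_of_v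 hϖ⟩ cx = (latticeGraph (galAdicCompletionMap (L := L) (IsCMField.complexConj L) hw) ϖ ((StdForm.antidiagonal 3).over (w.1.adicCompletion L))).dist ⟨stdLattice (w.1.adicCompletion L) 3, 0, isSelfDualLattice_stdLattice_three_of_v hϖ⟩ vtx + 1 ∧ latticeGraphIso (galAdicCompletionMap (L := L) (IsCMField.complexConj L) hw) ϖ ((StdForm.antidiagonal 3).over (w.1.adicCompletion L)) γ' cx = cx) ∧ ((latticeGraph (galAdicCompletionMap (L := L) (IsCMField.complexConj L) hw) ϖ ((StdForm.antidiagonal 3).over (w.1.adicCompletion L))).Adj cx wtx ∧ (latticeGraph (galAdicCompletionMap (L := L) (IsCMField.complexConj L) hw) ϖ ((StdForm.antidiagonal 3).over (w.1.adicCompletion L))).dist ⟨stdLattice (w.1.adicCompletion L) 3, 0, isSelfDualLattice_stdLattice_three_of_v hϖ⟩ wtx = (latticeGraph (galAdicCompletionMap (L := L) (IsCMField.complexConj L) hw) ϖ ((StdForm.antidiagonal 3).over (w.1.adicCompletion L))).dist ⟨stdLattice (w.1.adicCompletion L) 3, 0, isSelfDualLattice_stdLattice_three_of_v hϖ⟩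 cx + 1 ∧ latticeGraphIso (galAdicCompletionMap (L := L) (IsCMField.complexConj L) hw) ϖ ((StdForm.antidiagonal 3).over (w.1.adicCompletion L)) γ' wtx = wtx)} ∧ (¬ wtx.1.map ((Matrix.toLin' (((γ' : GL (Fin 3) (w.1.adicCompletion L)) : Matrix (Fin 3) (Fin 3) (w.1.adicCompletion L)) - 1)).restrictScalars (Valued.integer (w.1.adicCompletion L))) ≤ scaleLattice (ϖ ^ m) wtx.1 ∧ (wtx.1.map ((Matrix.toLin' (((γ' : GL (Fin 3) (w.1.adicCompletion L)) : Matrix (Fin 3) (Fin 3) (w.1.adicCompletion L)) - 1)).restrictScalars (Valued.integer (w.1.adicCompletion L))) ≤ scaleLattice (ϖ ^ (m - 1)) wtx.1 ∧ ¬ wtx.1.map ((Matrix.toLin' (((γ' : GL (Fin 3) (w.1.adicCompletion L)) : Matrix (Fin 3) (Fin 3) (w.1.adicCompletion L)) - 1)).restrictScalars (Valued.integer (w.1.adicCompletion L))) ≤ scaleLattice (ϖ ^ m) wtx.1))}).ncard =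
      Nat.card (Valued.ResidueField (w.1.adicCompletion L)) * Nat.card {p : Option {p : Valued.ResidueField (w.1.adicCompletion L) × Valued.ResidueField (w.1.adicCompletion L) // p.2 + (RingHom.id (Valued.ResidueField (w.1.adicCompletion L))) p.2 + p.1 * (RingHom.id (Valued.ResidueField (w.1.adicCompletion L))) p.1 = 0} //
        ((p.elim (Pi.single 2 1) fun q => ![(1 : Valued.ResidueField (w.1.adicCompletion L)), q.1.1, q.1.2]) ⬝ᵥ
          ((((StdForm.antidiagonal 3).over (Valued.ResidueField (w.1.adicCompletion L))) * (!![IsLocalRing.residue (Valued.integer (w.1.adicCompletion L)) (Y 0 0), 0, IsLocalRing.residue (Valued.integer (w.1.adicCompletion L)) (Y 0 1); 0, 0, 0; IsLocalRing.residue (Valued.integer (w.1.adicCompletion L)) (Y 1 0), 0, IsLocalRing.residue (Valued.integer (w.1.adicCompletion L)) (Y 1 1)] : Matrix (Fin 3) (Fin 3) (Valued.ResidueField (w.1.adicCompletion L)))) *ᵥ (p.elim (Pi.single 2 1) fun q => ![(1 : Valued.ResidueField (w.1.adicCompletion L)), q.1.1, q.1.2]))) = 0}) ∧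
    (∑ vtx ∈ ({⟨stdLattice (w.1.adicCompletion L) 3, 0, isSelfDualLattice_stdLattice_three_of_v hϖ⟩} : Finset {M : Submodule (Valued.integer (w.1.adicCompletion L)) (Fin 3 → (w.1.adicCompletion L)) // IsVertex (galAdicCompletionMap (L := L) (IsCMField.complexConj L) hw) ϖ ((StdForm.antidiagonal 3).over (w.1.adicCompletion L)) M}), ({wtx | wtx ∈ {wtx | ∃ cx, ((latticeGraph (galAdicCompletionMap (L := L) (IsCMField.complexConj L) hw) ϖ ((StdForm.antidiagonal 3).over (w.1.adicCompletion L))).Adj vtx cx ∧ (latticeGraph (galAdicCompletionMap (L := L) (IsCMField.complexConj L) hw) ϖ ((StdForm.antidiagonal 3).over (w.1.adicCompletion L))).dist ⟨stdLattice (w.1.adicCompletion L) 3, 0, isSelfDualLattice_stdLattice_three_of_v hϖ⟩ cx = (latticeGraph (galAdicCompletionMap (L := L) (IsCMField.complexConj L) hw) ϖ ((StdForm.antidiagonal 3).over (w.1.adicCompletion L))).dist ⟨stdLattice (w.1.adicCompletion L) 3, 0, isSelfDualLattice_stdLattice_three_of_v hϖ⟩ vtx + 1 ∧ latticeGraphIso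 (galAdicCompletionMap (L := L) (IsCMField.complexConj L) hw) ϖ ((StdForm.antidiagonal 3).over (w.1.adicCompletion L)) γ' cx = cx) ∧ ((latticeGraph (galAdicCompletionMap (L := L) (IsCMField.complexConj L) hw) ϖ ((StdForm.antidiagonal 3).over (w.1.adicCompletion L))).Adj cx wtx ∧ (latticeGraph (galAdicCompletionMap (L := L) (IsCMField.complexConj L) hw) ϖ ((StdForm.antidiagonal 3).over (w.1.adicCompletion L))).dist ⟨stdLattice (w.1.adicCompletion L) 3, 0, isSelfDualLattice_stdLattice_three_of_v hϖ⟩ wtx = (latticeGraph (galAdicCompletionMap (L := L) (IsCMField.complexConj L) hw) ϖ ((StdForm.antidiagonal 3).over (w.1.adicCompletion L))).dist ⟨stdLattice (w.1.adicCompletion L) 3, 0, isSelfDualLattice_stdLattice_three_of_v hϖ⟩ cx + 1 ∧ latticeGraphIso (galAdicCompletionMap (L := L) (IsCMField.complexConj L) hw) ϖ ((StdForm.antidiagonal 3).over (w.1.adicCompletion L)) γ' wtx = wtx)} ∧ (¬ wtx.1.map ((Matrix.toLin' (((γ' : GL (Fin 3) (w.1.adicCompletion L)) : Matrix (Fin 3)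 (Fin 3) (w.1.adicCompletion L)) - 1)).restrictScalars (Valued.integer (w.1.adicCompletion L))) ≤ scaleLattice (ϖ ^ m) wtx.1 ∧ (wtx.1.map ((Matrix.toLin' (((γ' : GL (Fin 3) (w.1.adicCompletion L)) : Matrix (Fin 3) (Fin 3) (w.1.adicCompletion L)) - 1)).restrictScalars (Valued.integer (w.1.adicCompletion L))) ≤ scaleLattice (ϖ ^ (m - 2)) wtx.1 ∧ ¬ wtx.1.map ((Matrix.toLin' (((γ' : GL (Fin 3) (w.1.adicCompletion L)) : Matrix (Fin 3) (Fin 3) (w.1.adicCompletion L)) - 1)).restrictScalars (Valued.integer (w.1.adicCompletion L))) ≤ scaleLattice (ϖ ^ (m - 1)) wtx.1) ∧ ∃ y ∈ wtx.1, ∃ a : (w.1.adicCompletion L), Valued.v a = 1 ∧ Valued.v ((ϖ ^ (m - 2))⁻¹ * pairing (galAdicCompletionMap (L := L) (IsCMField.complexConj L) hw) ((StdForm.antidiagonal 3).over (w.1.adicCompletion L)) y ((((γ' : GL (Fin 3) (w.1.adicCompletion L)) : Matrix (Fin 3) (Fin 3) (w.1.adicCompletion L)) - 1) *ᵥ y)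 - (c) * a ^ 2) < 1)}).ncard =
      Nat.card (Valued.ResidueField (w.1.adicCompletion L)) * Nat.card {p : Option {p : Valued.ResidueField (w.1.adicCompletion L) × Valued.ResidueField (w.1.adicCompletion L) // p.2 + (RingHom.id (Valued.ResidueField (w.1.adicCompletion L))) p.2 + p.1 * (RingHom.id (Valued.ResidueField (w.1.adicCompletion L))) p.1 = 0} //
        quadraticChar (Valued.ResidueField (w.1.adicCompletion L)) ((IsLocalRing.residue (Valued.integer (w.1.adicCompletion L)) (-c₀))⁻¹ * ((p.elim (Pi.single 2 1) fun q => ![(1 : Valued.ResidueField (w.1.adicCompletion L)), q.1.1, q.1.2]) ⬝ᵥ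
          ((((StdForm.antidiagonal 3).over (Valued.ResidueField (w.1.adicCompletion L))) * (!![IsLocalRing.residue (Valued.integer (w.1.adicCompletion L)) (Y 0 0), 0, IsLocalRing.residue (Valued.integer (w.1.adicCompletion L)) (Y 0 1); 0, 0, 0; IsLocalRing.residue (Valued.integer (w.1.adicCompletion L)) (Y 1 0), 0, IsLocalRing.residue (Valued.integer (w.1.adicCompletion L)) (Y 1 1)] : Matrix (Fin 3) (Fin 3) (Valued.ResidueField (w.1.adicCompletion L)))) *ᵥ (p.elim (Pi.single 2 1) fun q => ![(1 : Valued.ResidueField (w.1.adicCompletion L)), q.1.1, q.1.2])))) = 1}) ∧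
    (∑ vtx ∈ ({⟨stdLattice (w.1.adicCompletion L) 3, 0, isSelfDualLattice_stdLattice_three_of_v hϖ⟩} : Finset {M : Submodule (Valued.integer (w.1.adicCompletion L)) (Fin 3 → (w.1.adicCompletion L)) // IsVertex (galAdicCompletionMap (L := L) (IsCMField.complexConj L) hw) ϖ ((StdForm.antidiagonal 3).over (w.1.adicCompletion L)) M}), ({wtx | wtx ∈ {wtx | ∃ cx, ((latticeGraph (galAdicCompletionMap (L := L) (IsCMField.complexConj L) hw) ϖ ((StdForm.antidiagonal 3).over (w.1.adicCompletion L))).Adj vtx cx ∧ (latticeGraph (galAdicCompletionMap (L := L) (IsCMField.complexConj L) hw) ϖ ((StdForm.antidiagonal 3).over (w.1.adicCompletion L))).dist ⟨stdLattice (w.1.adicCompletion L) 3, 0, isSelfDualLattice_stdLattice_three_of_v hϖ⟩ cx = (latticeGraph (galAdicCompletionMap (L := L) (IsCMField.complexConj L) hw) ϖ ((StdForm.antidiagonal 3).over (w.1.adicCompletion L))).dist ⟨stdLattice (w.1.adicCompletion L) 3, 0, isSelfDualLattice_stdLattice_three_of_v hϖ⟩ vtx + 1 ∧ latticeGraphIso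 (galAdicCompletionMap (L := L) (IsCMField.complexConj L) hw) ϖ ((StdForm.antidiagonal 3).over (w.1.adicCompletion L)) γ' cx = cx) ∧ ((latticeGraph (galAdicCompletionMap (L := L) (IsCMField.complexConj L) hw) ϖ ((StdForm.antidiagonal 3).over (w.1.adicCompletion L))).Adj cx wtx ∧ (latticeGraph (galAdicCompletionMap (L := L) (IsCMField.complexConj L) hw) ϖ ((StdForm.antidiagonal 3).over (w.1.adicCompletion L))).dist ⟨stdLattice (w.1.adicCompletion L) 3, 0, isSelfDualLattice_stdLattice_three_of_v hϖ⟩ wtx = (latticeGraph (galAdicCompletionMap (L := L) (IsCMField.complexConj L) hw) ϖ ((StdForm.antidiagonal 3).over (w.1.adicCompletion L))).dist ⟨stdLattice (w.1.adicCompletion L) 3, 0, isSelfDualLattice_stdLattice_three_of_v hϖ⟩ cx + 1 ∧ latticeGraphIso (galAdicCompletionMap (L := L) (IsCMField.complexConj L) hw) ϖ ((StdForm.antidiagonal 3).over (w.1.adicCompletion L)) γ' wtx = wtx)} ∧ (¬ wtx.1.map ((Matrix.toLin' (((γ' : GL (Fin 3) (w.1.adicCompletion L)) : Matrix (Fin 3)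 (Fin 3) (w.1.adicCompletion L)) - 1)).restrictScalars (Valued.integer (w.1.adicCompletion L))) ≤ scaleLattice (ϖ ^ m) wtx.1 ∧ (wtx.1.map ((Matrix.toLin' (((γ' : GL (Fin 3) (w.1.adicCompletion L)) : Matrix (Fin 3) (Fin 3) (w.1.adicCompletion L)) - 1)).restrictScalars (Valued.integer (w.1.adicCompletion L))) ≤ scaleLattice (ϖ ^ (m - 2)) wtx.1 ∧ ¬ wtx.1.map ((Matrix.toLin' (((γ' : GL (Fin 3) (w.1.adicCompletion L)) : Matrix (Fin 3) (Fin 3) (w.1.adicCompletion L)) - 1)).restrictScalars (Valued.integer (w.1.adicCompletion L))) ≤ scaleLattice (ϖ ^ (m - 1)) wtx.1) ∧ ¬ (∃ y ∈ wtx.1, ∃ a : (w.1.adicCompletion L), Valued.v a = 1 ∧ Valued.v ((ϖ ^ (m - 2))⁻¹ * pairing (galAdicCompletionMap (L := L) (IsCMField.complexConj L) hw) ((StdForm.antidiagonal 3).over (w.1.adicCompletion L)) y ((((γ' : GL (Fin 3) (w.1.adicCompletion L)) : Matrix (Fin 3) (Fin 3) (w.1.adicCompletion L)) - 1) *ᵥ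 y) - (c) * a ^ 2) < 1))}).ncard =
      Nat.card (Valued.ResidueField (w.1.adicCompletion L)) * Nat.card {p : Option {p : Valued.ResidueField (w.1.adicCompletion L) × Valued.ResidueField (w.1.adicCompletion L) // p.2 + (RingHom.id (Valued.ResidueField (w.1.adicCompletion L))) p.2 + p.1 * (RingHom.id (Valued.ResidueField (w.1.adicCompletion L))) p.1 = 0} //
        quadraticChar (Valued.ResidueField (w.1.adicCompletion L)) ((IsLocalRing.residue (Valued.integer (w.1.adicCompletion L)) (-c₀))⁻¹ * ((p.elim (Pi.single 2 1) fun q => ![(1 : Valued.ResidueField (w.1.adicCompletion L)), q.1.1, q.1.2]) ⬝ᵥ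
          ((((StdForm.antidiagonal 3).over (Valued.ResidueField (w.1.adicCompletion L))) * (!![IsLocalRing.residue (Valued.integer (w.1.adicCompletion L)) (Y 0 0), 0, IsLocalRing.residue (Valued.integer (w.1.adicCompletion L)) (Y 0 1); 0, 0, 0; IsLocalRing.residue (Valued.integer (w.1.adicCompletion L)) (Y 1 0), 0, IsLocalRing.residue (Valued.integer (w.1.adicCompletion L)) (Y 1 1)] : Matrix (Fin 3) (Fin 3) (Valued.ResidueField (w.1.adicCompletion L)))) *ᵥ (p.elim (Pi.single 2 1) fun q => ![(1 : Valued.ResidueField (w.1.adicCompletion L)), q.1.1, q.1.2])))) = -1}) := by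
  classical
  have hmodd : Odd m := ⟨n, by omega⟩
  have hm3 : 3 ≤ m := by omega
  -- THE CM DRESS
  have hc1 : IsCMField.complexConj L ≠ 1 := IsCMField.complexConj_ne_one L
  have h2v : Valued.v (2 : (w.1.adicCompletion L)) = 1 := (isUnit_two_integer_iff_valued_eq_one L w.1).1 h2
  have hσσ : ∀ z : (w.1.adicCompletion L), (galAdicCompletionMap (L := L) (IsCMField.complexConj L) hw) ((galAdicCompletionMap (L := L) (IsCMField.complexConj L) hw) z) = z :=
    galAdicCompletionMap_galAdicCompletionMap_of_smul_eq (IsCMField.complexConj L) w hc1 hw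
  have hvσ : ∀ z : (w.1.adicCompletion L), Valued.v ((galAdicCompletionMap (L := L) (IsCMField.complexConj L) hw) z) = Valued.v z := fun z =>
    valued_galAdicCompletionMap (L := L) (IsCMField.complexConj L) hw z
  obtain ⟨-, -, -, hres, hnorm⟩ := ramifiedBlock_adicCompletion L v w hw he h2v
  haveI := isPrincipalIdealRing_integer_adicCompletion L v w
  have hqN : (Nat.card (Valued.ResidueField (w.1.adicCompletion L)) : ℂ) = (Ideal.absNorm v.asIdeal : ℂ) := by
    congr 1
    rw [← natCard_residueField_eq_of_compatible, natCard_residueField_eq_of_ramified (IsCMField.complexConj L) v hc1 w hw he, Ideal.absNorm_apply, Submodule.cardQuot_apply]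
  have hsq : ∀ t : (w.1.adicCompletion L), Valued.v (t - 1) < 1 → IsSquare t := fun t ht => by
    obtain ⟨r, hr, -⟩ := exists_sq_eq_of_valued_sub_one_lt w.1 h2v t ht
    exact ⟨r, by rw [← hr, sq]⟩
  have hϖ0 : ϖ ≠ 0 := fun h0 => by rw [h0, Valuation.map_zero] at hϖ; exact WithZero.exp_ne_zero hϖ.symm
  have hϖlt : Valued.v ϖ < 1 := by rw [hϖ, ← WithZero.exp_zero]; exact WithZero.exp_lt_exp.2 (by norm_num)
  have hlt1 : Valued.v ϖ ^ m < 1 := pow_lt_one₀ zero_le hϖlt (by omega)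
  have hT := isTree_latticeGraph_three_of_neg hσσ hvσ hϖ hσϖ hres h2v hnorm
  -- the centring unit `s` (`s·û₀₀ = 1`) and the W-centre `k` (A-p19 ∕ A-p12): `|B₀ − 1| ≤ |ϖ|^m`, `B₀ = k⁻¹(s·ĝ_w)k`
  have hγ'0 : γ' ∈ unitaryInt (galAdicCompletionMap (L := L) (IsCMField.complexConj L) hw) ((StdForm.antidiagonal 3).over (w.1.adicCompletion L)) := by
    have h := endoGL_one_mem_unitaryInt hϖlt (hγ' ▸ γ'.2) (d := m) (by omega) hd
    convert h using 1; exact Subtype.ext hγ'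
  -- `B₀ ∈ U(σ_w, !![0,1;1,0])`
  have hk' : k ∈ unitaryGroupOfForm (galAdicCompletionMap (L := L) (IsCMField.complexConj L) hw) (!![(0 : w.1.adicCompletion L), 1; 1, 0] : Matrix (Fin 2) (Fin 2) (w.1.adicCompletion L)) := by
    rw [← unitaryGroupOfForm_placeForm_antidiagTwo_eq]; exact hk
  have hg' : ((localNonsplitEquiv (IsCMField.complexConj L) (Matrix.of fun i j : Fin 2 => if i.val + j.val + 1 = 2 then (1 : L) else 0) (IsCMField.complexConj_ne_one L) w hw γH.1).val : GL (Fin 2) (w.1.adicCompletion L)) ∈ unitaryGroupOfForm (galAdicCompletionMap (L := L) (IsCMField.complexConj L) hw) (!![(0 : w.1.adicCompletion L), 1; 1, 0] : Matrix (Fin 2) (Fin 2) (w.1.adicCompletion L)) := by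
    rw [← unitaryGroupOfForm_placeForm_antidiagTwo_eq]
    exact (localNonsplitEquiv (IsCMField.complexConj L) (Matrix.of fun i j : Fin 2 => if i.val + j.val + 1 = 2 then (1 : L) else 0) (IsCMField.complexConj_ne_one L) w hw γH.1).2
  have hsnorm : (galAdicCompletionMap (L := L) (IsCMField.complexConj L) hw) (s : (w.1.adicCompletion L)) * (s : (w.1.adicCompletion L)) = 1 :=
    map_mul_self_eq_one_of_mul_oneByOne_eq_one (oneByOne_mem_unitaryGroupOfForm_antidiagonal_of_local L w hw γH.2) hs
  have hU : (k⁻¹ * (Matrix.GeneralLinearGroup.scalar (Fin 2) s * ((localNonsplitEquiv (IsCMField.complexConj L) (Matrix.of fun i j : Fin 2 => if i.val + j.val + 1 = 2 then (1 : L) else 0) (IsCMField.complexConj_ne_one L) w hw γH.1).val : GL (Fin 2) (w.1.adicCompletion L))) * k : GL (Fin 2) (w.1.adicCompletion L)) ∈ unitaryGroupOfForm (galAdicCompletionMap (L := L) (IsCMField.complexConj L) hw) (!![(0 : w.1.adicCompletion L), 1; 1, 0] : Matrix (Fin 2) (Fin 2) (w.1.adicCompletion L)) :=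
    Subgroup.mul_mem _ (Subgroup.mul_mem _ (Subgroup.inv_mem _ hk') (scalar_mul_mem_unitaryGroupOfForm hg' s hsnorm)) hk'
  -- the spectral data of `B₀`
  have hirr' := not_exists_isRoot_charpoly_rerootedCentred_ram L w hw γH hirr s k
  have hdisc' : Valued.v (((k⁻¹ * (Matrix.GeneralLinearGroup.scalar (Fin 2) s * ((localNonsplitEquiv (IsCMField.complexConj L) (Matrix.of fun i j : Fin 2 => if i.val + j.val + 1 = 2 then (1 : L) else 0) (IsCMField.complexConj_ne_one L) w hw γH.1).val : GL (Fin 2) (w.1.adicCompletion L))) * k : GL (Fin 2) (w.1.adicCompletion L)) : Matrix (Fin 2) (Fin 2) (w.1.adicCompletion L)).trace ^ 2 - 4 * ((k⁻¹ * (Matrix.GeneralLinearGroup.scalar (Fin 2) s * ((localNonsplitEquiv (IsCMField.complexConj L) (Matrix.of fun i j : Fin 2 => if i.val + j.val + 1 = 2 then (1 : L) else 0) (IsCMField.complexConj_ne_one L) w hw γH.1).val : GL (Fin 2) (w.1.adicCompletion L))) * k : GL (Fin 2) (w.1.adicCompletion L)) : Matrix (Fin 2) (Fin 2) (w.1.adicCompletion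 L)).det) = Valued.v ϖ ^ (2 * m) := by
    rw [v_disc_rerootedCentred_ram L w hw γH s hs k, hdisc, hϖ, ← WithZero.exp_nsmul, hmN]
    congr 1; push_cast; ring
  -- the leading matrix `Y = (ϖ^m)⁻¹(B₀ − 1) ∈ M₂(𝒪_w)`
  let Y : Matrix (Fin 2) (Fin 2) (Valued.integer (w.1.adicCompletion L)) := Matrix.of fun i j =>
    ⟨(ϖ ^ m)⁻¹ * (((k⁻¹ * (Matrix.GeneralLinearGroup.scalar (Fin 2) s * ((localNonsplitEquiv (IsCMField.complexConj L) (Matrix.of fun i j : Fin 2 => if i.val + j.val + 1 = 2 then (1 : L) else 0) (IsCMField.complexConj_ne_one L) w hw γH.1).val : GL (Fin 2) (w.1.adicCompletion L))) * k : GL (Fin 2) (w.1.adicCompletion L)) : Matrix (Fin 2) (Fin 2) (w.1.adicCompletion L)) - 1) i j, (Valuation.mem_integer_iff _ _).2 (by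
      rw [Valuation.map_mul, map_inv₀, map_pow]
      calc (Valued.v ϖ ^ m)⁻¹ * Valued.v ((((k⁻¹ * (Matrix.GeneralLinearGroup.scalar (Fin 2) s * ((localNonsplitEquiv (IsCMField.complexConj L) (Matrix.of fun i j : Fin 2 => if i.val + j.val + 1 = 2 then (1 : L) else 0) (IsCMField.complexConj_ne_one L) w hw γH.1).val : GL (Fin 2) (w.1.adicCompletion L))) * k : GL (Fin 2) (w.1.adicCompletion L)) : Matrix (Fin 2) (Fin 2) (w.1.adicCompletion L)) - 1) i j) ≤ (Valued.v ϖ ^ m)⁻¹ * Valued.v ϖ ^ m := mul_le_mul' le_rfl (hd i j)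
        _ = 1 := inv_mul_cancel₀ (pow_ne_zero _ ((Valuation.ne_zero_iff _).2 hϖ0)))⟩
  have hY : ∀ i j, ((Y i j : Valued.integer (w.1.adicCompletion L)) : (w.1.adicCompletion L)) = (ϖ ^ m)⁻¹ * (((k⁻¹ * (Matrix.GeneralLinearGroup.scalar (Fin 2) s * ((localNonsplitEquiv (IsCMField.complexConj L) (Matrix.of fun i j : Fin 2 => if i.val + j.val + 1 = 2 then (1 : L) else 0) (IsCMField.complexConj_ne_one L) w hw γH.1).val : GL (Fin 2) (w.1.adicCompletion L))) * k : GL (Fin 2) (w.1.adicCompletion L)) : Matrix (Fin 2) (Fin 2) (w.1.adicCompletion L)) - 1) i j := fun i j => rfl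
  -- THE W-ROOT-SET OF `B₀` AT LEVEL `m` IS `{𝒪²}` (A-p19 transport + chair's scalar depth + A-p12's innermost odd ball)
  obtain ⟨-, -, hA⟩ := typeTwo_depthDictionary_odd_ram L w hw he h2 ϖ hϖ hσϖ hblk hu2 hirr hdisc m hm β hβ
  obtain ⟨hHS, hsc⟩ := hA hmN
  have hsc' : Valued.v (2 * finGammaTwo L v γH w - ((((γH.1.val : GL (Fin 2) (UnitaryGroup.LocalRing L v)).val.map
      (Pi.evalRingHom (fun w' : PlacesOver L v => w'.1.adicCompletion L) w)))).trace) ≤ Valued.v (ϖ ^ m) := by rw [hmN]; exact hsc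
  have hWc := ncard_selfDual_fixed_lev_rerootedCentred_eq_ncard_ball_ram L w hw he h2 ϖ hϖ γH s hs k hk m hsc'
  have hball := selfDual_fixed_ball_odd_scale_eq L v w hw he h2 (Units.mk0 ϖ hϖ0) hϖ hσϖ (ϖ' := ϖ) ((localNonsplitEquiv (IsCMField.complexConj L) (Matrix.of fun i j : Fin 2 => if i.val + j.val + 1 = 2 then (1 : L) else 0) (IsCMField.complexConj_ne_one L) w hw γH.1).val : GL (Fin 2) (w.1.adicCompletion L))
    (localNonsplitEquiv (IsCMField.complexConj L) (Matrix.of fun i j : Fin 2 => if i.val + j.val + 1 = 2 then (1 : L) else 0) (IsCMField.complexConj_ne_one L) w hw γH.1).2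
    hblk hdisc (j := n) (by omega)
  have hcnt := ncard_selfDual_fixed_ball_of_odd_depth_ramified L v w hw he h2 (Units.mk0 ϖ hϖ0) hϖ hσϖ γH.1 hirr hblk hdisc (j := n) le_rfl
  simp only [Units.val_mk0] at hball hcnt
  rw [show n - n + 1 = 1 by omega, Finset.sum_range_one, pow_zero, mul_one] at hcnt
  have hball' : {B : Submodule (Valued.integer (w.1.adicCompletion L)) (Fin 2 → (w.1.adicCompletion L)) |
        IsSelfDualLattice (galAdicCompletionMap (L := L) (IsCMField.complexConj L) hw) ϖ (!![(0 : w.1.adicCompletion L), 1; 1, 0] : Matrix (Fin 2) (Fin 2) (w.1.adicCompletion L)) B ∧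
        mapGL ((localNonsplitEquiv (IsCMField.complexConj L) (Matrix.of fun i j : Fin 2 => if i.val + j.val + 1 = 2 then (1 : L) else 0) (IsCMField.complexConj_ne_one L) w hw γH.1).val : GL (Fin 2) (w.1.adicCompletion L)) B = B ∧
        B.map ((Matrix.toLin' ((((localNonsplitEquiv (IsCMField.complexConj L) (Matrix.of fun i j : Fin 2 => if i.val + j.val + 1 = 2 then (1 : L) else 0) (IsCMField.complexConj_ne_one L) w hw γH.1).val : GL (Fin 2) (w.1.adicCompletion L)) : Matrix (Fin 2) (Fin 2) (w.1.adicCompletion L)) - ((((localNonsplitEquiv (IsCMField.complexConj L) (Matrix.of fun i j : Fin 2 => if i.val + j.val + 1 = 2 then (1 : L) else 0) (IsCMField.complexConj_ne_one L) w hw γH.1).val : GL (Fin 2) (w.1.adicCompletion L)) : Matrix (Fin 2) (Fin 2) (w.1.adicCompletion L)).trace / 2) • (1 : Matrix (Fin 2) (Fin 2) (w.1.adicCompletion L)))).restrictScalars (Valued.integer (w.1.adicCompletion L))) ≤ scaleLattice (ϖ ^ (m)) B} = {B : Submodule (Valued.integer (w.1.adicCompletion L)) (Fin 2 → (w.1.adicCompletion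 L)) |
        IsSelfDualLattice (galAdicCompletionMap (L := L) (IsCMField.complexConj L) hw) ϖ (!![(0 : w.1.adicCompletion L), 1; 1, 0] : Matrix (Fin 2) (Fin 2) (w.1.adicCompletion L)) B ∧
        mapGL ((localNonsplitEquiv (IsCMField.complexConj L) (Matrix.of fun i j : Fin 2 => if i.val + j.val + 1 = 2 then (1 : L) else 0) (IsCMField.complexConj_ne_one L) w hw γH.1).val : GL (Fin 2) (w.1.adicCompletion L)) B = B ∧
        B.map ((Matrix.toLin' ((((localNonsplitEquiv (IsCMField.complexConj L) (Matrix.of fun i j : Fin 2 => if i.val + j.val + 1 = 2 then (1 : L) else 0) (IsCMField.complexConj_ne_one L) w hw γH.1).val : GL (Fin 2) (w.1.adicCompletion L)) : Matrix (Fin 2) (Fin 2) (w.1.adicCompletion L)) - ((((localNonsplitEquiv (IsCMField.complexConj L) (Matrix.of fun i j : Fin 2 => if i.val + j.val + 1 = 2 then (1 : L) else 0) (IsCMField.complexConj_ne_one L) w hw γH.1).val : GL (Fin 2) (w.1.adicCompletion L)) : Matrix (Fin 2) (Fin 2) (w.1.adicCompletion L)).trace / 2) • (1 : Matrix (Fin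 2) (Fin 2) (w.1.adicCompletion L)))).restrictScalars (Valued.integer (w.1.adicCompletion L))) ≤ scaleLattice (ϖ ^ (2 * n)) B} := by
    rw [hmN]; exact hball
  have hW1 : {B : Submodule (Valued.integer (w.1.adicCompletion L)) (Fin 2 → (w.1.adicCompletion L)) |
        IsSelfDualLattice (galAdicCompletionMap (L := L) (IsCMField.complexConj L) hw) ϖ (!![(0 : w.1.adicCompletion L), 1; 1, 0] : Matrix (Fin 2) (Fin 2) (w.1.adicCompletion L)) B ∧
        mapGL (k⁻¹ * (Matrix.GeneralLinearGroup.scalar (Fin 2) s * ((localNonsplitEquiv (IsCMField.complexConj L) (Matrix.of fun i j : Fin 2 => if i.val + j.val + 1 = 2 then (1 : L) else 0) (IsCMField.complexConj_ne_one L) w hw γH.1).val : GL (Fin 2) (w.1.adicCompletion L))) * k : GL (Fin 2) (w.1.adicCompletion L)) B = B ∧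
        B.map ((Matrix.toLin' (((k⁻¹ * (Matrix.GeneralLinearGroup.scalar (Fin 2) s * ((localNonsplitEquiv (IsCMField.complexConj L) (Matrix.of fun i j : Fin 2 => if i.val + j.val + 1 = 2 then (1 : L) else 0) (IsCMField.complexConj_ne_one L) w hw γH.1).val : GL (Fin 2) (w.1.adicCompletion L))) * k : GL (Fin 2) (w.1.adicCompletion L)) : Matrix (Fin 2) (Fin 2) (w.1.adicCompletion L)) - 1)).restrictScalars (Valued.integer (w.1.adicCompletion L))) ≤ scaleLattice (ϖ ^ m) B}.ncard = 1 := by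
    rw [hWc, hball']; omega
  have hBint : IsIntMatrix ((k⁻¹ * (Matrix.GeneralLinearGroup.scalar (Fin 2) s * ((localNonsplitEquiv (IsCMField.complexConj L) (Matrix.of fun i j : Fin 2 => if i.val + j.val + 1 = 2 then (1 : L) else 0) (IsCMField.complexConj_ne_one L) w hw γH.1).val : GL (Fin 2) (w.1.adicCompletion L))) * k : GL (Fin 2) (w.1.adicCompletion L)) : Matrix (Fin 2) (Fin 2) (w.1.adicCompletion L)) := isIntMatrix_of_forall_v_sub_one_lt_one _ fun i j => (hd i j).trans_lt hlt1
  have hBinv : IsIntMatrix (((k⁻¹ * (Matrix.GeneralLinearGroup.scalar (Fin 2) s * ((localNonsplitEquiv (IsCMField.complexConj L) (Matrix.of fun i j : Fin 2 => if i.val + j.val + 1 = 2 then (1 : L) else 0) (IsCMField.complexConj_ne_one L) w hw γH.1).val : GL (Fin 2) (w.1.adicCompletion L))) * k : GL (Fin 2) (w.1.adicCompletion L))⁻¹ : GL (Fin 2) (w.1.adicCompletion L)) : Matrix (Fin 2) (Fin 2) (w.1.adicCompletion L)) :=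
    isIntMatrix_coe_inv_of_forall_v_sub_one_le_of_lt_one hlt1 hd
  have hstd : stdLattice (w.1.adicCompletion L) 2 ∈ {B : Submodule (Valued.integer (w.1.adicCompletion L)) (Fin 2 → (w.1.adicCompletion L)) |
        IsSelfDualLattice (galAdicCompletionMap (L := L) (IsCMField.complexConj L) hw) ϖ (!![(0 : w.1.adicCompletion L), 1; 1, 0] : Matrix (Fin 2) (Fin 2) (w.1.adicCompletion L)) B ∧
        mapGL (k⁻¹ * (Matrix.GeneralLinearGroup.scalar (Fin 2) s * ((localNonsplitEquiv (IsCMField.complexConj L) (Matrix.of fun i j : Fin 2 => if i.val + j.val + 1 = 2 then (1 : L) else 0) (IsCMField.complexConj_ne_one L) w hw γH.1).val : GL (Fin 2) (w.1.adicCompletion L))) * k : GL (Fin 2) (w.1.adicCompletion L)) B = B ∧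
        B.map ((Matrix.toLin' (((k⁻¹ * (Matrix.GeneralLinearGroup.scalar (Fin 2) s * ((localNonsplitEquiv (IsCMField.complexConj L) (Matrix.of fun i j : Fin 2 => if i.val + j.val + 1 = 2 then (1 : L) else 0) (IsCMField.complexConj_ne_one L) w hw γH.1).val : GL (Fin 2) (w.1.adicCompletion L))) * k : GL (Fin 2) (w.1.adicCompletion L)) : Matrix (Fin 2) (Fin 2) (w.1.adicCompletion L)) - 1)).restrictScalars (Valued.integer (w.1.adicCompletion L))) ≤ scaleLattice (ϖ ^ m) B} := by
    refine ⟨?_, (mapGL_stdLattice_eq_iff _).2 ⟨hBint, hBinv⟩, ?_⟩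
    · rw [← stdForm_antidiagonal_two_over_eq]; exact isSelfDualLattice_stdLattice_two_of_v hϖ
    · have h := map_sub_one_latt_le_scaleLattice_iff (pow_ne_zero m hϖ0) (k⁻¹ * (Matrix.GeneralLinearGroup.scalar (Fin 2) s * ((localNonsplitEquiv (IsCMField.complexConj L) (Matrix.of fun i j : Fin 2 => if i.val + j.val + 1 = 2 then (1 : L) else 0) (IsCMField.complexConj_ne_one L) w hw γH.1).val : GL (Fin 2) (w.1.adicCompletion L))) * k : GL (Fin 2) (w.1.adicCompletion L)) 1
      rw [Units.val_one, latt_one, inv_one, one_mul, mul_one] at h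
      exact h.2 fun i j => by rw [map_pow]; exact hd i j
  have hWtop : {B : Submodule (Valued.integer (w.1.adicCompletion L)) (Fin 2 → (w.1.adicCompletion L)) |
        IsSelfDualLattice (galAdicCompletionMap (L := L) (IsCMField.complexConj L) hw) ϖ (!![(0 : w.1.adicCompletion L), 1; 1, 0] : Matrix (Fin 2) (Fin 2) (w.1.adicCompletion L)) B ∧
        mapGL (k⁻¹ * (Matrix.GeneralLinearGroup.scalar (Fin 2) s * ((localNonsplitEquiv (IsCMField.complexConj L) (Matrix.of fun i j : Fin 2 => if i.val + j.val + 1 = 2 then (1 : L) else 0) (IsCMField.complexConj_ne_one L) w hw γH.1).val : GL (Fin 2) (w.1.adicCompletion L))) * k : GL (Fin 2) (w.1.adicCompletion L)) B = B ∧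
        B.map ((Matrix.toLin' (((k⁻¹ * (Matrix.GeneralLinearGroup.scalar (Fin 2) s * ((localNonsplitEquiv (IsCMField.complexConj L) (Matrix.of fun i j : Fin 2 => if i.val + j.val + 1 = 2 then (1 : L) else 0) (IsCMField.complexConj_ne_one L) w hw γH.1).val : GL (Fin 2) (w.1.adicCompletion L))) * k : GL (Fin 2) (w.1.adicCompletion L)) : Matrix (Fin 2) (Fin 2) (w.1.adicCompletion L)) - 1)).restrictScalars (Valued.integer (w.1.adicCompletion L))) ≤ scaleLattice (ϖ ^ m) B} = {stdLattice (w.1.adicCompletion L) 2} := by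
    obtain ⟨B, hB⟩ := Set.ncard_eq_one.1 hW1
    rw [hB] at hstd ⊢
    rw [Set.mem_singleton_iff.1 hstd]
  -- the residual data of `B₀` and the non-square token `ε := 4·Y₀₁Y₁₀`
  have hdiag := v_leading_diag_sub_lt_one hvσ hσϖ hϖ hres hU hmodd Y hY
  have h4 := forall_v_sq_sub_four_mul_eq_one h2v hsq hϖ hirr' hdisc' Y hY hdiag
  have hεv : Valued.v (4 * (((Y 0 1 : Valued.integer (w.1.adicCompletion L)) : (w.1.adicCompletion L)) * ((Y 1 0 : Valued.integer (w.1.adicCompletion L)) : (w.1.adicCompletion L)))) = 1 := by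
    have h := h4 0 (by rw [map_zero]; exact zero_le_one)
    rwa [zero_pow two_ne_zero, zero_sub, Valuation.map_neg] at h
  -- THE ROOT PACKAGE (★ p849330) with the atoms := the child-set sizes, and THE JUNCTION (★ p849383)
  have hk2 : ringChar (Valued.ResidueField (w.1.adicCompletion L)) ≠ 2 := ringChar_residueField_ne_two h2v
  have hdiagr := residue_leading_diag_eq hvσ hσϖ hϖ hres hU hmodd Y hY
  have hirrr := quadraticChar_residue_leading_offDiag_eq_neg_one h2v hsq hϖ hirr' hdisc' Y hY hdiag
  have hchar : (((γ' : GL (Fin 3) (w.1.adicCompletion L)) : Matrix (Fin 3) (Fin 3) (w.1.adicCompletion L))).charpoly = (X - C 1) * (((k⁻¹ * (Matrix.GeneralLinearGroup.scalar (Fin 2) s * ((localNonsplitEquiv (IsCMField.complexConj L) (Matrix.of fun i j : Fin 2 => if i.val + j.val + 1 = 2 then (1 : L) else 0) (IsCMField.complexConj_ne_one L) w hw γH.1).val : GL (Fin 2) (w.1.adicCompletion L))) * k : GL (Fin 2) (w.1.adicCompletion L)) : Matrix (Fin 2) (Fin 2) (w.1.adicCompletion L))).charpoly := by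
    rw [hγ']; exact charpoly_coe_endoGL_one _
  have hvϖ0 : 0 < Valued.v ϖ := by rw [hϖ]; exact WithZero.exp_pos
  obtain ⟨hsR, hPE, hPP, hPM⟩ := rootRegionPackage_hyperbolic_of_lineCounts hσσ hvσ hσϖ hϖ hres h2v hT hγ'0 (k⁻¹ * (Matrix.GeneralLinearGroup.scalar (Fin 2) s * ((localNonsplitEquiv (IsCMField.complexConj L) (Matrix.of fun i j : Fin 2 => if i.val + j.val + 1 = 2 then (1 : L) else 0) (IsCMField.complexConj_ne_one L) w hw γH.1).val : GL (Fin 2) (w.1.adicCompletion L))) * k : GL (Fin 2) (w.1.adicCompletion L)) hγ' hm3 hmodd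
    (fun x e he hlev => map_sub_one_pow_three_le_scaleLattice_of_charpoly_block_antidiagonal hϖ hchar (d := e) (by rw [sub_self, map_zero]; exact zero_le)
      (fun i j => (hd i j).trans (pow_le_pow_right_of_le_one' hϖlt.le he)) x hlev)
    hd (fun t ht => by rw [v_det_sub_smul_one_eq_of_leading h2v hϖ Y hY hdiag h4 t ht]; exact pow_lt_pow_right_of_lt_one₀ hvϖ0 hϖlt (by omega))
    (by rw [hγ']; exact map_sub_one_stdLattice_le_scaleLattice_endoGL_one hϖ0 hd) hWtop c _ hc hεv h4 _ _ _ rfl rfl rfl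
  let Y₀ : Matrix (Fin 3) (Fin 3) (Valued.integer (w.1.adicCompletion L)) := !![Y 0 0, 0, Y 0 1; 0, 0, 0; Y 1 0, 0, Y 1 1]
  have hY₀ : ∀ i j, ((Y₀ i j : Valued.integer (w.1.adicCompletion L)) : (w.1.adicCompletion L)) =
      (ϖ ^ m)⁻¹ * ((((γ' : GL (Fin 3) (w.1.adicCompletion L)) : Matrix (Fin 3) (Fin 3) (w.1.adicCompletion L)) - 1) i j) := by
    intro i j
    rw [hγ', coe_endoGL_sub_one_eq_endoShape]
    fin_cases i <;> fin_cases j <;> simp [Y₀, hY]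
  have hc₀O : Valued.v (c₀ : (w.1.adicCompletion L)) ≤ 1 := c₀.2
  have hc₀' : (c₀ : (w.1.adicCompletion L)) = c := hc₀
  have hE := ncard_rootChildren_null_eq_natCard hσσ hvσ hσϖ hϖ hres h2v γ' Y₀ hY₀
  have hP := ncard_rootChildren_negClass_eq_natCard hσσ hvσ hσϖ hϖ hres h2v γ' Y₀ hY₀ c c₀ hc₀' hc
  have hM := ncard_rootChildren_negClass_mul_eq_natCard hσσ hvσ hσϖ hϖ hres h2v γ' Y₀ hY₀ c _ c₀
    ⟨4 * (((Y 0 1 : Valued.integer (w.1.adicCompletion L)) : (w.1.adicCompletion L)) * ((Y 1 0 : Valued.integer (w.1.adicCompletion L)) : (w.1.adicCompletion L))), hεv.le⟩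
    hc₀' rfl hc hεv h4
  rw [hE] at hPE
  rw [hP] at hPP
  rw [hM] at hPM
  have hYB : Y₀.map (IsLocalRing.residue (Valued.integer (w.1.adicCompletion L))) = (!![IsLocalRing.residue (Valued.integer (w.1.adicCompletion L)) (Y 0 0), 0, IsLocalRing.residue (Valued.integer (w.1.adicCompletion L)) (Y 0 1); 0, 0, 0; IsLocalRing.residue (Valued.integer (w.1.adicCompletion L)) (Y 1 0), 0, IsLocalRing.residue (Valued.integer (w.1.adicCompletion L)) (Y 1 1)] : Matrix (Fin 3) (Fin 3) (Valued.ResidueField (w.1.adicCompletion L))) := by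
    ext i j; fin_cases i <;> fin_cases j <;> simp [Y₀]
  rw [hYB] at hPE hPP hPM
  -- THE SIGN: `χ(det Ȳ_W) = (β, θ)_v` via `det(B₀ − 1) = s²·(χ_g(u))_w`
  have hsv : Valued.v (s : (w.1.adicCompletion L)) = 1 := by
    have h := congrArg Valued.v hs
    rwa [map_mul, v_oneByOne_eq_one_of_local L w hw γH.2, mul_one, map_one] at h
  have hq := eval_finCharpolyTwo_finGammaTwo_apply_eq_quadratic L v w γH
  have hev : (((localNonsplitEquiv (IsCMField.complexConj L) (Matrix.of fun i j : Fin 2 => if i.val + j.val + 1 = 2 then (1 : L) else 0) (IsCMField.complexConj_ne_one L) w hw γH.1).val : GL (Fin 2) (w.1.adicCompletion L)) : Matrix (Fin 2) (Fin 2) (w.1.adicCompletion L)).charpoly.eval ((((localNonsplitEquiv (IsCMField.complexConj L) (Matrix.of fun i j : Fin 1 => if i.val + j.val + 1 = 1 then (1 : L) else 0) (IsCMField.complexConj_ne_one L) w hw γH.2).val : GL (Fin 1) (w.1.adicCompletion L)) : Matrix (Fin 1) (Fin 1) (w.1.adicCompletion L)) 0 0) = ((finCharpolyTwo L v γH).eval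 (finGammaTwo L v γH)) w := by
    rw [coe_localNonsplitEquiv_apply, coe_localNonsplitEquiv_apply, hq, eval_charpoly_fin_two_eq_det_sub_smul_one, Matrix.det_fin_two, Matrix.trace_fin_two,
      Matrix.det_fin_two]
    simp only [Matrix.sub_apply, Matrix.smul_apply, Matrix.map_apply, Matrix.one_apply_eq, ne_eq, zero_ne_one, not_false_eq_true, Matrix.one_apply_ne, one_ne_zero,
      smul_eq_mul, mul_one, mul_zero, sub_zero, Pi.evalRingHom_apply, finGammaTwo]
    ring
  have hdetB : (((k⁻¹ * (Matrix.GeneralLinearGroup.scalar (Fin 2) s * ((localNonsplitEquiv (IsCMField.complexConj L) (Matrix.of fun i j : Fin 2 => if i.val + j.val + 1 = 2 then (1 : L) else 0) (IsCMField.complexConj_ne_one L) w hw γH.1).val : GL (Fin 2) (w.1.adicCompletion L))) * k : GL (Fin 2) (w.1.adicCompletion L)) : Matrix (Fin 2) (Fin 2) (w.1.adicCompletion L)) - 1).det = (s : (w.1.adicCompletion L)) ^ 2 * ((finCharpolyTwo L v γH).eval (finGammaTwo L v γH)) w := by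
    rw [det_coe_inv_conj_scalar_mul_sub_one k _ s rfl hs, ← eval_charpoly_fin_two_eq_det_sub_smul_one, hev]
  have hpm0 : (ϖ ^ m : (w.1.adicCompletion L)) ≠ 0 := pow_ne_zero _ hϖ0
  have hYdet : (((Y 0 0 * Y 1 1 - Y 0 1 * Y 1 0 : Valued.integer (w.1.adicCompletion L)) : Valued.integer (w.1.adicCompletion L)) : (w.1.adicCompletion L)) =
      (s : (w.1.adicCompletion L)) ^ 2 * (((finCharpolyTwo L v γH).eval (finGammaTwo L v γH)) w / ϖ ^ (2 * m)) := by
    have e : (((Y 0 0 * Y 1 1 - Y 0 1 * Y 1 0 : Valued.integer (w.1.adicCompletion L)) : Valued.integer (w.1.adicCompletion L)) : (w.1.adicCompletion L)) =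
        ((ϖ ^ m)⁻¹) ^ 2 * (((k⁻¹ * (Matrix.GeneralLinearGroup.scalar (Fin 2) s * ((localNonsplitEquiv (IsCMField.complexConj L) (Matrix.of fun i j : Fin 2 => if i.val + j.val + 1 = 2 then (1 : L) else 0) (IsCMField.complexConj_ne_one L) w hw γH.1).val : GL (Fin 2) (w.1.adicCompletion L))) * k : GL (Fin 2) (w.1.adicCompletion L)) : Matrix (Fin 2) (Fin 2) (w.1.adicCompletion L)) - 1).det := by
      simp only [AddSubgroupClass.coe_sub, MulMemClass.coe_mul, hY, Matrix.det_fin_two]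
      ring
    rw [e, hdetB, pow_mul, ← inv_pow]
    ring
  have hvdet : Valued.v ((((Y 0 0 * Y 1 1 - Y 0 1 * Y 1 0 : Valued.integer (w.1.adicCompletion L)) : Valued.integer (w.1.adicCompletion L)) : (w.1.adicCompletion L))) = 1 := by
    have e : (((Y 0 0 * Y 1 1 - Y 0 1 * Y 1 0 : Valued.integer (w.1.adicCompletion L)) : Valued.integer (w.1.adicCompletion L)) : (w.1.adicCompletion L)) =
        ((ϖ ^ m)⁻¹) ^ 2 * (((k⁻¹ * (Matrix.GeneralLinearGroup.scalar (Fin 2) s * ((localNonsplitEquiv (IsCMField.complexConj L) (Matrix.of fun i j : Fin 2 => if i.val + j.val + 1 = 2 then (1 : L) else 0) (IsCMField.complexConj_ne_one L) w hw γH.1).val : GL (Fin 2) (w.1.adicCompletion L))) * k : GL (Fin 2) (w.1.adicCompletion L)) : Matrix (Fin 2) (Fin 2) (w.1.adicCompletion L)) - 1).det := by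
      simp only [AddSubgroupClass.coe_sub, MulMemClass.coe_mul, hY, Matrix.det_fin_two]
      ring
    rw [e, Valuation.map_mul, map_pow, map_inv₀, v_det_rerootedCentred_sub_one_eq_ram L w hw he ϖ hϖ γH m hm s hs k, map_pow, inv_pow, ← pow_mul, mul_comm m 2,
      inv_mul_cancel₀ (pow_ne_zero _ ((Valuation.ne_zero_iff _).2 hϖ0))]
  have hres0 : IsLocalRing.residue (Valued.integer (w.1.adicCompletion L)) (Y 0 0 * Y 1 1 - Y 0 1 * Y 1 0) ≠ 0 := fun h => by
    rw [residue_eq_zero_iff_v_lt_one, hvdet] at h; exact lt_irrefl _ h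
  have hs0r : IsLocalRing.residue (Valued.integer (w.1.adicCompletion L)) ⟨(s : (w.1.adicCompletion L)), hsv.le⟩ ≠ 0 := fun h => by
    rw [residue_eq_zero_iff_v_lt_one] at h; exact (ne_of_lt h) hsv
  have hHS1 := typeTwo_hilbertSymbol_eq_one_iff_exists_sq_ram L w hw he h2 ϖ hϖ hσϖ hblk hu2 hmodd hm β hβ
  have hbridge : (∃ z : w.1.adicCompletion L, Valued.v z = 1 ∧ Valued.v (((finCharpolyTwo L v γH).eval (finGammaTwo L v γH)) w / ϖ ^ (2 * m) - z ^ 2) < 1) ↔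
      quadraticChar (Valued.ResidueField (w.1.adicCompletion L)) (IsLocalRing.residue (Valued.integer (w.1.adicCompletion L)) (Y 0 0 * Y 1 1 - Y 0 1 * Y 1 0)) = 1 := by
    have key := exists_unit_v_sub_mul_sq_lt_one_iff_residue (Y 0 0 * Y 1 1 - Y 0 1 * Y 1 0) (⟨(s : (w.1.adicCompletion L)), hsv.le⟩ ^ 2)
    have hs2 : Valued.v ((s : (w.1.adicCompletion L)) ^ 2) = 1 := by rw [map_pow, hsv, one_pow]
    have step1 : (∃ z : w.1.adicCompletion L, Valued.v z = 1 ∧ Valued.v (((finCharpolyTwo L v γH).eval (finGammaTwo L v γH)) w / ϖ ^ (2 * m) - z ^ 2) < 1) ↔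
        ∃ a₀ : w.1.adicCompletion L, Valued.v a₀ = 1 ∧ Valued.v ((((Y 0 0 * Y 1 1 - Y 0 1 * Y 1 0 : Valued.integer (w.1.adicCompletion L)) : Valued.integer (w.1.adicCompletion L)) : (w.1.adicCompletion L)) -
          (((⟨(s : (w.1.adicCompletion L)), hsv.le⟩ ^ 2 : Valued.integer (w.1.adicCompletion L)) : Valued.integer (w.1.adicCompletion L)) : (w.1.adicCompletion L)) * a₀ ^ 2) < 1 := by
      refine exists_congr fun z => and_congr_right fun _ => ?_
      rw [hYdet, show (((⟨(s : (w.1.adicCompletion L)), hsv.le⟩ ^ 2 : Valued.integer (w.1.adicCompletion L)) : Valued.integer (w.1.adicCompletion L)) : (w.1.adicCompletion L)) =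
        (s : (w.1.adicCompletion L)) ^ 2 by push_cast; rfl, ← mul_sub, Valuation.map_mul, hs2, one_mul]
    rw [step1, key]
    have step2 : (∃ a : Valued.ResidueField (w.1.adicCompletion L), a ≠ 0 ∧ IsLocalRing.residue (Valued.integer (w.1.adicCompletion L)) (Y 0 0 * Y 1 1 - Y 0 1 * Y 1 0) =
        IsLocalRing.residue (Valued.integer (w.1.adicCompletion L)) (⟨(s : (w.1.adicCompletion L)), hsv.le⟩ ^ 2) * a ^ 2) ↔
        ∃ b : Valued.ResidueField (w.1.adicCompletion L), b ≠ 0 ∧ IsLocalRing.residue (Valued.integer (w.1.adicCompletion L)) (Y 0 0 * Y 1 1 - Y 0 1 * Y 1 0) = 1 * b ^ 2 := by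
      constructor
      · rintro ⟨a, ha, h⟩
        exact ⟨IsLocalRing.residue (Valued.integer (w.1.adicCompletion L)) ⟨(s : (w.1.adicCompletion L)), hsv.le⟩ * a, mul_ne_zero hs0r ha, by rw [h, map_pow]; ring⟩
      · rintro ⟨b, hb, h⟩
        refine ⟨(IsLocalRing.residue (Valued.integer (w.1.adicCompletion L)) ⟨(s : (w.1.adicCompletion L)), hsv.le⟩)⁻¹ * b, mul_ne_zero (inv_ne_zero hs0r) hb, ?_⟩
        rw [h, map_pow]; field_simp
    rw [step2, exists_ne_zero_eq_mul_sq_iff_quadraticChar one_ne_zero, inv_one, one_mul]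
  exact ⟨Y, hY, hdiagr, hirrr, hHS1.trans hbridge, hsR, hPE, hPP, hPM⟩

end Literature.NumberTheory.Rogawski1990.BlockLawHyp

end
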